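import Summits.CriticalPhenomena.PercolationContinuityZ3.Theorems.SahiMasterFamilyPointwise
import Summits.CriticalPhenomena.PercolationContinuityZ3.Theorems.PercNearOneGluingNoHeavyLowerTailSahiCombJuntaFour
import Summits.CriticalPhenomena.PercolationContinuityZ3.Theorems.PercNearOneGluingNoHeavyLowerTailSahiCombCore

/-!
# The POINTWISE master equality conjecture (EQ-3) on at most four shared coordinates — COMPUTATIONAL companion of
# `SahiMasterFamilyPointwise.lean`

Unit `prim-master-conj` (crux anchor stmt-CriticalPhenomena-4575, helper work), gen 13.  Proposed `--computational`: every theorem here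
has the `native_decide` certificate `SahiC3Cube.checkCube_four` ((M⁺-3) on four coins, cell `prim-l12` seat P3 / prim-sahi) in its axiom
closure (`Lean.ofReduceBool`); nothing else non-standard, no `sorry`.

`SahiMasterFamilyPointwise.lean` (standard axioms) shows that a comb (tensor-Bernstein) certificate for `p ↦ E_k(μ_p; 1_U)` makes the
master equality conjecture pointwise for the family `U` (`Pointwise.sahiE_ind_eq_zero_iff_of_combPos`, via (EQI-k) at every order).
With the kernel certificate of (M⁺-3) on cubes of `≤ 4` coordinates (`SahiC3CombCube.combPos_sahiE_three_family_of_card_le_four`) and seat P3's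
private-coordinate elimination (`SahiCombPrivate.combPos_sahiE_ind_of_core'`, `SahiCombCore.combPos_of_determinedBy_of_cube`):

* `combPos_sahiE_three_of_core_le_four` — **(M⁺-3) for every triple of increasing events whose pairwise-shared coordinates lie in a set of
  size `≤ 4`** (the comb-level companion of the law-level `SahiCombCore.sahiE_ind_nonneg_of_core_le_four`);
* `sahiE_three_ind_eq_zero_iff_of_card_le_four` — **`MasterFamilyEqIff 3` on every ground set with at most four elements**: for `p` in
  the open cube and increasing `U₀, U₁, U₂ ⊆ 2^ι`, `|ι| ≤ 4`: `E₃(μ_p; 1_U) = 0 ↔ U ∈ Z₃`;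
* `sahiE_three_ind_eq_zero_iff_of_core_le_four`, `…_of_inter_determinedBy_card_le_four` — the same for triples with a core of `≤ 4`
  coordinates (any number of private coordinates) and for `(U, A, B)` with `A ∩ B` determined by `≤ 4` coordinates;
* strict forms (`…_pos_…`): on these classes a triple outside `Z₃` — in particular every pairwise-dependent triple — has `E₃(μ_p) > 0`
  at EVERY interior `p`: Kahn's Conjecture 5 in strict form there.
Nothing here asserts (EQ-3) or Kahn's conjecture in general. [this work]
-/

noncomputable section

open scoped Classical

namespace Summit.CriticalPhenomena.PercolationContinuityZ3.Theorems

open Finset Function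
open Literature.Combinatorics.Sahi2008
open Literature.Probability.LatticeModels.Kahn2022 (Affects)
open Literature.Probability.Percolation (DeterminedBy)
open Literature.Probability.Percolation.DecisionTree (ind)
open SahiComb

namespace Pointwise

variable {ι : Type} [Fintype ι]

/-! ### (M⁺-3) for cores of at most four coordinates -/

/-- **(M⁺-3) for triples with a core of at most four coordinates** (computational): if every coordinate outside a set `S` with `|S| ≤ 4`
affects at most one of `U₀, U₁, U₂`, then `p ↦ E₃(μ_p; 1_U)` is comb-positive at multidegree `3`. [this work] -/
theorem combPos_sahiE_three_of_core_le_four (S : Finset ι) (hS4 : S.card ≤ 4) (U : Fin 3 → Set (Set ι)) (hU : ∀ j, IsUpperSet (U j))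
    (hpriv : ∀ e, e ∉ S → ∀ j j', Affects (U j) e → Affects (U j') e → j = j') :
    CombPos (fun _ : ι => 3) (fun p => sahiE (bernoulliWeight p) 3 (fun j => ind (U j))) :=
  SahiCombPrivate.combPos_sahiE_ind_of_core' S (fun V hVu hVd => SahiCombCore.combPos_of_determinedBy_of_cube S
    (fun W hW => SahiC3CombCube.combPos_sahiE_three_family_of_card_le_four (by rw [Fintype.card_coe]; exact hS4) W hW) V hVu hVd)
    U hU hpriv

/-! ### Pointwise (EQ-3) on at most four (shared) coordinates -/

/-- **`MasterFamilyEqIff 3` on ground sets of size `≤ 4`** (computational): for `p` in the open cube and three increasing events of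
`2^ι`, `|ι| ≤ 4`: `E₃(μ_p; 1_U) = 0 ↔ U ∈ Z₃`. [this work] -/
theorem sahiE_three_ind_eq_zero_iff_of_card_le_four (hι : Fintype.card ι ≤ 4) (p : ι → unitInterval)
    (hp : ∀ e, (p e : ℝ) ∈ Set.Ioo (0 : ℝ) 1) (U : Fin 3 → Set (Set ι)) (hU : ∀ j, IsUpperSet (U j)) :
    sahiE (bernoulliWeight p) 3 (fun j => ind (U j)) = 0 ↔ SuppZeroFlag 3 U :=
  sahiE_ind_eq_zero_iff_of_combPos hU (SahiC3CombCube.combPos_sahiE_three_family_of_card_le_four hι U hU) hp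

/-- The `MasterFamilyEqIff`-shaped statement restricted to ground sets of size `≤ 4`. [this work] -/
theorem masterFamilyEqIff_three_of_card_le_four :
    ∀ (ι : Type) [Fintype ι], Fintype.card ι ≤ 4 → ∀ (p : ι → unitInterval), (∀ e, (p e : ℝ) ∈ Set.Ioo (0 : ℝ) 1) →
      ∀ U : Fin 3 → Set (Set ι), (∀ j, IsUpperSet (U j)) →
        (sahiE (bernoulliWeight p) 3 (fun j => ind (U j)) = 0 ↔ SuppZeroFlag 3 U) :=
  fun _ _ hι p hp U hU => sahiE_three_ind_eq_zero_iff_of_card_le_four hι p hp U hU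

/-- Strict Kahn on `≤ 4` coordinates: a triple outside `Z₃` has `E₃(μ_p) > 0` at every interior `p`. [this work] -/
theorem sahiE_three_ind_pos_of_card_le_four (hι : Fintype.card ι ≤ 4) (p : ι → unitInterval)
    (hp : ∀ e, (p e : ℝ) ∈ Set.Ioo (0 : ℝ) 1) (U : Fin 3 → Set (Set ι)) (hU : ∀ j, IsUpperSet (U j)) (hZ : ¬ SuppZeroFlag 3 U) :
    0 < sahiE (bernoulliWeight p) 3 (fun j => ind (U j)) :=
  sahiE_ind_pos_of_combPos hU (SahiC3CombCube.combPos_sahiE_three_family_of_card_le_four hι U hU) hZ hp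

/-- In particular a PAIRWISE-DEPENDENT triple (no deleted pair in `Z₂`) on `≤ 4` coordinates has `E₃ > 0` throughout the open cube. [this work] -/
theorem sahiE_three_ind_pos_of_pairwiseDependent_card_le_four (hι : Fintype.card ι ≤ 4) (p : ι → unitInterval)
    (hp : ∀ e, (p e : ℝ) ∈ Set.Ioo (0 : ℝ) 1) (U : Fin 3 → Set (Set ι)) (hU : ∀ j, IsUpperSet (U j))
    (hno : ∀ m : Fin 3, ¬ SuppZeroFlag 2 (fun j => U (m.succAbove j))) :
    0 < sahiE (bernoulliWeight p) 3 (fun j => ind (U j)) :=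
  sahiE_three_ind_pos_of_card_le_four hι p hp U hU fun hZ => by
    obtain ⟨m, hm, -⟩ := hZ
    exact hno m hm

/-- **Pointwise (EQ-3) for triples with a core of at most four coordinates** (computational). [this work] -/
theorem sahiE_three_ind_eq_zero_iff_of_core_le_four (p : ι → unitInterval) (hp : ∀ e, (p e : ℝ) ∈ Set.Ioo (0 : ℝ) 1)
    (S : Finset ι) (hS4 : S.card ≤ 4) (U : Fin 3 → Set (Set ι)) (hU : ∀ j, IsUpperSet (U j))
    (hpriv : ∀ e, e ∉ S → ∀ j j', Affects (U j) e → Affects (U j') e → j = j') :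
    sahiE (bernoulliWeight p) 3 (fun j => ind (U j)) = 0 ↔ SuppZeroFlag 3 U :=
  sahiE_ind_eq_zero_iff_of_combPos hU (combPos_sahiE_three_of_core_le_four S hS4 U hU hpriv) hp

/-- Strict form for cores of `≤ 4` coordinates. [this work] -/
theorem sahiE_three_ind_pos_of_core_le_four (p : ι → unitInterval) (hp : ∀ e, (p e : ℝ) ∈ Set.Ioo (0 : ℝ) 1)
    (S : Finset ι) (hS4 : S.card ≤ 4) (U : Fin 3 → Set (Set ι)) (hU : ∀ j, IsUpperSet (U j))
    (hpriv : ∀ e, e ∉ S → ∀ j j', Affects (U j) e → Affects (U j') e → j = j') (hZ : ¬ SuppZeroFlag 3 U) :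
    0 < sahiE (bernoulliWeight p) 3 (fun j => ind (U j)) :=
  sahiE_ind_pos_of_combPos hU (combPos_sahiE_three_of_core_le_four S hS4 U hU hpriv) hZ hp

/-- **Pointwise (EQ-3) for `(U, A, B)` with `A ∩ B` determined by at most four coordinates** (computational; comb certificate
`SahiCombJunta.combPos_sahiE_three_of_inter_determinedBy_card_le_four`). [this work] -/
theorem sahiE_three_ind_eq_zero_iff_of_inter_determinedBy_card_le_four (p : ι → unitInterval)
    (hp : ∀ e, (p e : ℝ) ∈ Set.Ioo (0 : ℝ) 1) (W : Finset ι) (hW : W.card ≤ 4) {U A B : Set (Set ι)} (hU : IsUpperSet U)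
    (hA : IsUpperSet A) (hB : IsUpperSet B) (hK : DeterminedBy (A ∩ B) (↑W : Set ι)) :
    sahiE (bernoulliWeight p) 3 ![ind U, ind A, ind B] = 0 ↔ SuppZeroFlag 3 ![U, A, B] := by
  have hfam : ∀ j, IsUpperSet ((![U, A, B] : Fin 3 → Set (Set ι)) j) := by
    intro j; fin_cases j <;> assumption
  have e : (fun j => ind ((![U, A, B] : Fin 3 → Set (Set ι)) j)) = ![ind U, ind A, ind B] := by
    funext j; fin_cases j <;> rfl
  have hC : CombPos (fun _ : ι => 3) (fun p => sahiE (bernoulliWeight p) 3 (fun j => ind ((![U, A, B] : Fin 3 → Set (Set ι)) j))) :=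
    (SahiCombJunta.combPos_sahiE_three_of_inter_determinedBy_card_le_four W hW hU hA hB hK).congr fun p => by rw [e]
  rw [← e]
  exact sahiE_ind_eq_zero_iff_of_combPos hfam hC hp

end Pointwise

end Summit.CriticalPhenomena.PercolationContinuityZ3.Theorems
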